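import Summits.Ventures.LatticeQCDFlow.Scoring.SchwingerDysonPhi4Lattice
import Mathlib.Probability.Distributions.Gaussian.Real
import Mathlib.Analysis.SpecialFunctions.Gaussian.GaussianIntegral
import HarnessLib

/-!
# Heat bath on the free field, I: the one-site kernel and the random scan on linear observables

HONEST FRAMING: exact (Metropolis-corrected) sampling algorithms for lattice gauge theory;
figures of merit are autocorrelation/cost numbers at stated couplings and volumes; no
continuum-physics claim.  (SCALAR calibration rung S0-A: not a gauge result.)

Venture `LatticeQCDFlow` (cell pub-lqcd), sub-topic `Scoring`; FANOUT row 2 (`s0-phi4`: 2D φ⁴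
calibration — real-NVP flows vs HMC vs LOCAL updates, dynamical exponents `z`; exactness battery,
free-field limit).  NEW WORK of the cell (elementary: one Gaussian integral and finite sums);
nothing is cited as a fact.  Printed counterparts, named only: Adler 1981 (stochastic
over-relaxation), Goodman–Sokal 1989 (Phys. Rev. D 40, 2035: heat bath on a Gaussian is a
stochastic Gauss–Seidel iteration), Fox–Parker 2017 (Bernoulli 23: Gibbs samplers ≙ matrix
splittings; Table 2: Gibbs = Gauss–Seidel, ω-relaxed Gibbs = SOR), Kazashi–Müller–Scheichl 2024
(arXiv:2407.12149, Alg. 2 eq. (3.3) and §3.3 eq. (3.7), and p. 3: "upon taking the expectation,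
the mean of the iterates is identical to the iterates in deterministic [Gauss–Seidel]").

## What is proved (any finite site set `Λ`, any real coupling matrix `J`, `λ = 0`)

With `S(φ) = Σ φJφ` (`latticePhi4Action J 0` of `Scoring/SchwingerDysonPhi4Lattice.lean`; the
engine's free field is `J = shiftCoupling σ m² = −Δ_lat + m²`) and `F_x = ∂S/∂φ_x`
(`latticePhi4Force J 0`, affine in `φ_x`: `latticePhi4Force_zero_eq`):

* `hbMean J φ x = φ_x − F_x(φ)/(2J_{xx})` — the conditional mean of `φ_x` given the other sites
  (`hbMean_eq`: `= −b_x/(2J_{xx})`; `hbMean_update`: depends on the exterior only);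
  `latticePhi4Action_update_sq` — completing the square along the coordinate line,
  `S(φ|φ_x:=t) = J_{xx}(t − μ_x)² + S(φ|φ_x:=μ_x)`;
* **`heatBath_condDensity`** — for `J_{xx} > 0` the normalised conditional density
  `e^{−S(φ|φ_x:=t)} / ∫ e^{−S(φ|φ_x:=s)} ds` IS Mathlib's `gaussianPDFReal μ_x(φ) (1/(2J_{xx})) t`:
  the conditional law of one site is `N(μ_x(φ), 1/(2J_{xx}))`, the law the heat bath draws from
  (Mathlib `integral_gaussian` + translation invariance);
* `siteUpdate J ω x` — the ONE-STEP TRANSITION OPERATOR of Adler's over-relaxed heat bath at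
  site `x` acting on observables, `(P_x^ω f)(φ) = E[f(φ with φ_x := t)]`,
  `t ∼ N(φ_x − ωF_x(φ)/(2J_{xx}), ω(2−ω)/(2J_{xx}))` (`ω = 1`: the heat bath / Gibbs sampler, whose
  law is the conditional law above); `siteUpdate_one` (Markov), `siteUpdate_const_mul`, and
  **`siteUpdate_linear`**: on a linear observable `ℓ·φ = Σ_y ℓ_y φ_y`,
  `P_x^ω(ℓ·)(φ) = ℓ·φ − ω ℓ_x F_x(φ)/(2J_{xx})` — the Gauss–Seidel (`ω = 1`) / SOR coordinate
  relaxation step of the quadratic form, the noise averaging out (`integral_id_gaussianReal`);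
* `scanUpdate J ω = |Λ|⁻¹ Σ_x siteUpdate J ω x` — one step of the RANDOM-SCAN sweep (site drawn
  uniformly); `scanUpdate_one`, `scanUpdate_const_mul`, **`scanUpdate_linear`**:
  `P^ω(ℓ·)(φ) = ℓ·φ − (ω/|Λ|) Σ_x ℓ_x F_x(φ)/(2J_{xx})` (averaged Jacobi relaxation).

The companion `Scoring/FreeFieldHeatBathSpectrum.lean` diagonalises `scanUpdate` on the engine's
plane waves and derives the exact autocorrelation functions and `τ_int` (`z = 2`).  NOT CLAIMED
here: invariance of the joint Gibbs law on `ℝ^Λ` under `siteUpdate` (the one-site conditional law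
IS resampled exactly by `heatBath_condDensity`; the lifting is the pattern of the finite-space
`Exactness/HeatBath.lean` / `LocalUpdates.lean`); the ordered sweep; anything at `λ > 0`.
-/

namespace Summit.Ventures.LatticeQCDFlow.Scoring

open Real MeasureTheory ProbabilityTheory Finset Filter

section Site

variable {Λ : Type*} [Fintype Λ] [DecidableEq Λ]

/-- The conditional mean of `φ_x` given the other sites under the free weight `e^{−Σ φJφ}`:
`μ_x(φ) = φ_x − F_x(φ) / (2 J_{xx})`, `F_x = ∂S/∂φ_x` the force at `λ = 0`. -/
noncomputable def hbMean (J : Λ → Λ → ℝ) (φ : Λ → ℝ) (x : Λ) : ℝ :=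
  φ x - latticePhi4Force J 0 φ x / (2 * J x x)

/-- The one-site transition operator of Adler's over-relaxed heat bath with parameter `ω`
(`ω = 1`: the heat bath / Gibbs sampler), acting on observables:
`(P_x^ω f)(φ) = E f(φ with φ_x := t)`, `t ∼ N(φ_x − ω F_x(φ)/(2J_{xx}), ω(2−ω)/(2J_{xx}))`. -/
noncomputable def siteUpdate (J : Λ → Λ → ℝ) (ω : ℝ) (x : Λ) (f : (Λ → ℝ) → ℝ) (φ : Λ → ℝ) : ℝ :=
  ∫ t, f (Function.update φ x t)
    ∂gaussianReal (φ x - ω * (latticePhi4Force J 0 φ x / (2 * J x x)))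
      (Real.toNNReal (ω * (2 - ω) / (2 * J x x)))

/-- The free force is affine in `φ_x`: `F_x(φ) = 2 J_{xx} φ_x + b_x(φ)` with
`b_x(φ) = Σ_y (J_{xy} + J_{yx}) (φ with φ_x := 0)_y`. -/
theorem latticePhi4Force_zero_eq (J : Λ → Λ → ℝ) (φ : Λ → ℝ) (x : Λ) :
    latticePhi4Force J 0 φ x
      = 2 * J x x * φ x + ∑ y, (J x y + J y x) * Function.update φ x 0 y := by
  have h := latticePhi4Force_eq J 0 φ x
  rw [← h]
  ring

/-- `μ_x(φ) = −b_x(φ) / (2 J_{xx})`. -/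
theorem hbMean_eq (J : Λ → Λ → ℝ) (φ : Λ → ℝ) (x : Λ) (hJ : J x x ≠ 0) :
    hbMean J φ x = -(∑ y, (J x y + J y x) * Function.update φ x 0 y) / (2 * J x x) := by
  unfold hbMean
  rw [latticePhi4Force_zero_eq]
  field_simp
  ring

/-- The conditional mean depends on the exterior only. -/
theorem hbMean_update (J : Λ → Λ → ℝ) (φ : Λ → ℝ) (x : Λ) (hJ : J x x ≠ 0) (t : ℝ) :
    hbMean J (Function.update φ x t) x = hbMean J φ x := by
  rw [hbMean_eq J _ x hJ, hbMean_eq J _ x hJ, Function.update_idem]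

/-- **Completing the square.**  At `λ = 0`, along the coordinate line of site `x`:
`S(φ with φ_x := t) = J_{xx} (t − μ_x(φ))² + S(φ with φ_x := μ_x(φ))`. -/
theorem latticePhi4Action_update_sq (J : Λ → Λ → ℝ) (φ : Λ → ℝ) (x : Λ) (hJ : J x x ≠ 0)
    (t : ℝ) :
    latticePhi4Action J 0 (Function.update φ x t)
      = J x x * (t - hbMean J φ x) ^ 2
        + latticePhi4Action J 0 (Function.update φ x (hbMean J φ x)) := by
  rw [latticePhi4Action_update J 0 φ x t, latticePhi4Action_update J 0 φ x (hbMean J φ x),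
    hbMean_eq J φ x hJ]
  field_simp
  ring

/-- **The conditional law of one site is Gaussian.**  For `J_{xx} > 0` the normalised density of
`φ_x = t` given the other sites, `e^{−S(φ|φ_x:=t)} / ∫ e^{−S(φ|φ_x:=s)} ds`, IS the normal density
with mean `μ_x(φ)` and variance `1/(2J_{xx})` — the law the heat bath draws from. -/
theorem heatBath_condDensity (J : Λ → Λ → ℝ) (φ : Λ → ℝ) (x : Λ) (hJ : 0 < J x x) (t : ℝ) :
    Real.exp (-latticePhi4Action J 0 (Function.update φ x t))
        / ∫ s, Real.exp (-latticePhi4Action J 0 (Function.update φ x s))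
      = gaussianPDFReal (hbMean J φ x) (Real.toNNReal (1 / (2 * J x x))) t := by
  set a := J x x with ha
  set m := hbMean J φ x with hm
  set C := latticePhi4Action J 0 (Function.update φ x m) with hC
  have hsq : ∀ s, Real.exp (-latticePhi4Action J 0 (Function.update φ x s))
      = Real.exp (-C) * Real.exp (-a * (s - m) ^ 2) := by
    intro s
    rw [latticePhi4Action_update_sq J φ x hJ.ne' s, ← Real.exp_add]
    congr 1
    ring
  have hint : ∫ s, Real.exp (-latticePhi4Action J 0 (Function.update φ x s))
      = Real.exp (-C) * Real.sqrt (Real.pi / a) := by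
    simp only [hsq]
    rw [integral_const_mul]
    congr 1
    have h := integral_sub_right_eq_self (μ := (volume : Measure ℝ))
      (fun s => Real.exp (-a * s ^ 2)) m
    rw [h]
    exact integral_gaussian a
  rw [hint, hsq t, gaussianPDFReal_def]
  simp only []
  have hv : ((Real.toNNReal (1 / (2 * a)) : NNReal) : ℝ) = 1 / (2 * a) :=
    Real.coe_toNNReal _ (by positivity)
  rw [hv]
  have hpi : 0 < Real.pi := Real.pi_pos
  have h2 : Real.sqrt (2 * Real.pi * (1 / (2 * a))) = Real.sqrt (Real.pi / a) := by
    congr 1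
    field_simp
  have h3 : -(t - m) ^ 2 / (2 * (1 / (2 * a))) = -a * (t - m) ^ 2 := by
    field_simp
  rw [h2, h3, mul_div_mul_left _ _ (Real.exp_pos (-C)).ne', div_eq_inv_mul]

/-! ## The one-site kernel on linear observables -/

/-- Pointwise: `Σ_y ℓ_y (φ with φ_x := t)_y` splits off the `x` term. -/
theorem linear_update (ℓ φ : Λ → ℝ) (x : Λ) (t : ℝ) :
    ∑ y, ℓ y * Function.update φ x t y = (∑ y, ℓ y * Function.update φ x 0 y) + ℓ x * t := by
  have h : ∀ y ∈ (Finset.univ : Finset Λ), ℓ y * Function.update φ x t y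
      = ℓ y * Function.update φ x 0 y + t * (if y = x then ℓ y else 0) := by
    intro y _
    rw [update_apply_eq_add_ite φ x t y]
    split_ifs <;> ring
  rw [Finset.sum_congr rfl h, Finset.sum_add_distrib, ← Finset.mul_sum,
    Finset.sum_ite_eq' Finset.univ x ℓ, if_pos (Finset.mem_univ x)]
  ring

/-- The same split for `φ` itself: `Σ_y ℓ_y φ_y = Σ_y ℓ_y (φ with φ_x := 0)_y + ℓ_x φ_x`. -/
theorem linear_split (ℓ φ : Λ → ℝ) (x : Λ) :
    ∑ y, ℓ y * φ y = (∑ y, ℓ y * Function.update φ x 0 y) + ℓ x * φ x := by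
  have h := linear_update ℓ φ x (φ x)
  rwa [Function.update_eq_self] at h

/-- `t ↦ t` is integrable under a real Gaussian. -/
theorem integrable_id_gaussianReal' (m : ℝ) (v : NNReal) :
    Integrable (fun t : ℝ => t) (gaussianReal m v) := by
  have h := memLp_id_gaussianReal' (μ := m) (v := v) 1 ENNReal.one_ne_top
  exact memLp_one_iff_integrable.mp h

/-- **The over-relaxed heat bath on a linear observable** `ℓ·φ = Σ_y ℓ_y φ_y`:
`(P_x^ω ℓ·)(φ) = ℓ·φ − ω ℓ_x F_x(φ) / (2 J_{xx})` — the deterministic Gauss–Seidel / SOR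
coordinate relaxation of the quadratic form, the noise averaging out. -/
theorem siteUpdate_linear (J : Λ → Λ → ℝ) (ω : ℝ) (x : Λ) (ℓ φ : Λ → ℝ) :
    siteUpdate J ω x (fun φ => ∑ y, ℓ y * φ y) φ
      = (∑ y, ℓ y * φ y) - ω * ℓ x * (latticePhi4Force J 0 φ x / (2 * J x x)) := by
  set K := ∑ y, ℓ y * Function.update φ x 0 y with hK
  have hfun : (fun t : ℝ => ∑ y, ℓ y * Function.update φ x t y) = fun t => K + ℓ x * t := by
    funext t
    exact linear_update ℓ φ x t
  unfold siteUpdate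
  simp only []
  rw [hfun, integral_add (integrable_const _) ((integrable_id_gaussianReal' _ _).const_mul (ℓ x)),
    integral_const, integral_const_mul, integral_id_gaussianReal, smul_eq_mul, probReal_univ,
    one_mul, linear_split ℓ φ x]
  ring

/-- Linearity of the kernel in the observable: constants factor out. -/
theorem siteUpdate_const_mul (J : Λ → Λ → ℝ) (ω : ℝ) (x : Λ) (c : ℝ) (f : (Λ → ℝ) → ℝ)
    (φ : Λ → ℝ) :
    siteUpdate J ω x (fun ψ => c * f ψ) φ = c * siteUpdate J ω x f φ := by
  unfold siteUpdate
  exact integral_const_mul c _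

/-- The kernel is Markov: `P_x^ω 1 = 1`. -/
theorem siteUpdate_one (J : Λ → Λ → ℝ) (ω : ℝ) (x : Λ) (φ : Λ → ℝ) :
    siteUpdate J ω x (fun _ => (1 : ℝ)) φ = 1 := by
  unfold siteUpdate
  rw [integral_const, smul_eq_mul, probReal_univ, one_mul]

end Site

/-! ## The random-scan sweep -/

section Scan

variable {Λ : Type*} [Fintype Λ] [DecidableEq Λ]

/-- One step of the RANDOM-SCAN `ω`-heat bath: a site is drawn uniformly, then updated by
`P_x^ω`; as an operator on observables `P^ω f = |Λ|⁻¹ Σ_x P_x^ω f`. -/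
noncomputable def scanUpdate (J : Λ → Λ → ℝ) (ω : ℝ) (f : (Λ → ℝ) → ℝ) (φ : Λ → ℝ) : ℝ :=
  (Fintype.card Λ : ℝ)⁻¹ * ∑ x, siteUpdate J ω x f φ

/-- Constants factor out of the scan operator. -/
theorem scanUpdate_const_mul (J : Λ → Λ → ℝ) (ω c : ℝ) (f : (Λ → ℝ) → ℝ) (φ : Λ → ℝ) :
    scanUpdate J ω (fun ψ => c * f ψ) φ = c * scanUpdate J ω f φ := by
  unfold scanUpdate
  simp only [siteUpdate_const_mul, ← Finset.mul_sum]
  ring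

/-- The scan operator is Markov: `P^ω 1 = 1`. -/
theorem scanUpdate_one [Nonempty Λ] (J : Λ → Λ → ℝ) (ω : ℝ) (φ : Λ → ℝ) :
    scanUpdate J ω (fun _ => (1 : ℝ)) φ = 1 := by
  unfold scanUpdate
  simp only [siteUpdate_one, Finset.sum_const, Finset.card_univ, nsmul_eq_mul, mul_one]
  have h : (Fintype.card Λ : ℝ) ≠ 0 := Nat.cast_ne_zero.mpr Fintype.card_ne_zero
  exact inv_mul_cancel₀ h

/-- **The random scan on a linear observable**:
`(P^ω ℓ·)(φ) = ℓ·φ − (ω/|Λ|) Σ_x ℓ_x F_x(φ)/(2J_{xx})` — averaged Jacobi relaxation. -/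
theorem scanUpdate_linear [Nonempty Λ] (J : Λ → Λ → ℝ) (ω : ℝ) (ℓ φ : Λ → ℝ) :
    scanUpdate J ω (fun ψ => ∑ y, ℓ y * ψ y) φ
      = (∑ y, ℓ y * φ y)
        - ω * (Fintype.card Λ : ℝ)⁻¹ * ∑ x, ℓ x * (latticePhi4Force J 0 φ x / (2 * J x x)) := by
  unfold scanUpdate
  simp only [siteUpdate_linear, Finset.sum_sub_distrib, Finset.sum_const, Finset.card_univ,
    nsmul_eq_mul]
  have h : (Fintype.card Λ : ℝ) ≠ 0 := Nat.cast_ne_zero.mpr Fintype.card_ne_zero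
  rw [mul_sub, ← mul_assoc, inv_mul_cancel₀ h, one_mul, Finset.mul_sum, Finset.mul_sum]
  congr 1
  exact Finset.sum_congr rfl fun x _ => by ring

end Scan

end Summit.Ventures.LatticeQCDFlow.Scoring
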